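import Literature.MathematicalPhysics.QuantumFieldTheory.LatticeMaxwellBlockGaussianIBP
import Literature.MathematicalPhysics.QuantumFieldTheory.LatticeMaxwellBlockSteinInterpolation
import HarnessLib

/-!
# Stein's equation for the lattice-Maxwell block law (Meckes 2009, Lemma 1 (3)) — DISCHARGE of
# `Meckes2009_lemma1_steinEquation_latticeMaxwellBlock`

The named fact of `LatticeMaxwellBlockOU.lean` — for `g ∈ C^∞` with bounded first and second
derivative, `U_o g = latticeMaxwellBlockStein B D g` solves `−L_B (U_o g) = g − γ_B(g)` pointwise,
`L_B = latticeMaxwellBlockGenerator B D` the Ornstein–Uhlenbeck generator of the block marginal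
`γ_B = latticeMaxwellBlockLaw B D` of the curvature Gaussian field (`d ≥ 3`) — is PROVED here
(`Meckes2009_lemma1_steinEquation_latticeMaxwellBlock_holds`), following Meckes' proof:

1. `SteinOU.sub_integral_eq_integral_deriv_gaussInterp` (`…SteinInterpolation.lean`):
   `g(y) − E g(Z) = ∫₀¹ d/dt E g(Z_{y,t}) dt`, `d/dt E g(Z_{y,t}) = E[Dg(Z_{y,t})(y/(2√t) − Z/(2√(1−t)))]`;
2. `deriv_gaussInterp_eq` — by Gaussian integration by parts for the block law
   (`integral_fderiv_apply_self_latticeMaxwellBlockLaw`, Meckes' Lemma 1 (1)) applied to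
   `z ↦ g(√t y + √(1−t) z)`: for `0 < t < 1`,
   `d/dt E g(Z_{y,t}) = (2√t)⁻¹ E[Dg(Z_{y,t}) y] − ½ Σ_{s,t'} Γ_B(s,t') E[∂_{t'}∂_s g(Z_{y,t})]`,
   i.e. `= −(2t)⁻¹ (L_B E g(Z_{·,t}))(y)`;
3. `neg_latticeMaxwellBlockGenerator_stein` — exchanging `L_B` with `∫₀¹ dt` through the
   derivative formulas `SteinOU.fderiv_steinInverse_apply`, `SteinOU.fderiv_fderiv_steinInverse_apply`
   (`…SteinRegularity.lean`): **`−L_B (U_o g)(y) = g(y) − γ_B(g)`** for `g ∈ C²` with bounded `Dg`,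
   `D²g`; the named fact (stated for `g ∈ C^∞`) follows.

References: E. Meckes, *On Stein's method for multivariate normal approximation*, IMS Collections 5
(2009) 153–178, arXiv:0902.0333, Lemma 1 and its proof [Meckes2009]; S. Chatterjee, E. Meckes,
ALEA 4 (2008) 257–283, arXiv:math/0701464, Lemma 2 [ChatterjeeMeckes2007].
-/

noncomputable section

open MeasureTheory ProbabilityTheory Filter Set
open scoped Topology
open Literature.MathematicalPhysics.QuantumLattice (ZdPlaquette)

namespace Literature.MathematicalPhysics.QuantumFieldTheory

/-! ### A measurability lemma for the general layer -/

namespace SteinOU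

variable {E : Type*} [NormedAddCommGroup E] [NormedSpace ℝ E] [MeasurableSpace E] [BorelSpace E]
  [SecondCountableTopology E] {γ : Measure E} [SFinite γ] {g : E → ℝ}

/-- `t ↦ E g(√t x + √(1−t) Z)` is measurable for continuous `g` (joint continuity of the
integrand). [cite: Meckes2009, proof of Lemma 1 (3)] -/
theorem measurable_gaussInterp_of_continuous (hg : Continuous g) (x : E) :
    Measurable fun t : ℝ => gaussInterp γ g t x := by
  have hc : Continuous fun p : ℝ × E => g (Real.sqrt p.1 • x + Real.sqrt (1 - p.1) • p.2) :=
    hg.comp (by fun_prop)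
  exact (hc.stronglyMeasurable.integral_prod_right' (ν := γ)).measurable

end SteinOU

section Block

open Literature.MathematicalPhysics.QuantumLattice

variable {d : ℕ} (B : Finset (ZdPlaquette d)) (D : ℕ)

/-! ### The `t`-derivative of the interpolation is `−(2t)⁻¹ L_B` applied to it -/

section Interp

variable {E : Type*} [NormedAddCommGroup E] [NormedSpace ℝ E]

/-- The interpolation path `z ↦ √t x + √(1−t) z` is affine with linear part `√(1−t)·id`.
[cite: Meckes2009, proof of Lemma 1 (3)] -/
theorem hasFDerivAt_interp_affine (t : ℝ) (x z : E) :
    HasFDerivAt (fun z : E => Real.sqrt t • x + Real.sqrt (1 - t) • z)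
      (Real.sqrt (1 - t) • ContinuousLinearMap.id ℝ E) z :=
  ((hasFDerivAt_id z).const_smul (Real.sqrt (1 - t))).const_add (Real.sqrt t • x)

/-- Chain rule in `z` along the interpolation:
`D[h(√t x + √(1−t)·)](z)[w] = √(1−t) · Dh(Z_{x,t})[w]`. [cite: Meckes2009, proof of Lemma 1 (3)] -/
theorem fderiv_comp_interp_apply {h : E → ℝ} (hh : Differentiable ℝ h) (t : ℝ) (x z w : E) :
    fderiv ℝ (fun z : E => h (Real.sqrt t • x + Real.sqrt (1 - t) • z)) z w =
      Real.sqrt (1 - t) * fderiv ℝ h (Real.sqrt t • x + Real.sqrt (1 - t) • z) w := by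
  rw [show (fun z : E => h (Real.sqrt t • x + Real.sqrt (1 - t) • z)) =
      h ∘ fun z : E => Real.sqrt t • x + Real.sqrt (1 - t) • z from rfl,
    ((hh _).hasFDerivAt.comp z (hasFDerivAt_interp_affine t x z)).fderiv]
  simp [smul_eq_mul]

end Interp

/-- **The `t`-derivative of the interpolation in generator form** (the heart of Meckes' proof of
Lemma 1 (3): "by Lemma 1 (1), `E[Z_Σ · ∇g(Z_{x,t})] = √(1−t) E⟨Hess g(Z_{x,t}), Σ⟩`"): for `g ∈ C²`
with bounded `Dg`, `D²g`, `0 < t < 1`,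
`E[Dg(Z_{x,t})(x/(2√t) − Z/(2√(1−t)))] = (2√t)⁻¹ E[Dg(Z_{x,t}) x] − ½ Σ_{s,t'} Γ_B(s,t') E[∂_{t'}∂_s g(Z_{x,t})]`
under the block law (`d ≥ 3`). [cite: Meckes2009, proof of Lemma 1 (3)] -/
theorem deriv_gaussInterp_eq (hd : 3 ≤ d) {g : (↥B → Fin D → ℝ) → ℝ} {C C₂ : ℝ}
    (hg : ContDiff ℝ 2 g) (hC : ∀ y, ‖fderiv ℝ g y‖ ≤ C)
    (hC₂ : ∀ y, ‖fderiv ℝ (fderiv ℝ g) y‖ ≤ C₂) (x : ↥B → Fin D → ℝ) {t : ℝ}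
    (ht : t ∈ Set.Ioo (0 : ℝ) 1) :
    ∫ z, fderiv ℝ g (Real.sqrt t • x + Real.sqrt (1 - t) • z)
        ((1 / (2 * Real.sqrt t)) • x - (1 / (2 * Real.sqrt (1 - t))) • z) ∂latticeMaxwellBlockLaw B D =
      1 / (2 * Real.sqrt t) *
          SteinOU.gaussInterp (latticeMaxwellBlockLaw B D) (fun y => fderiv ℝ g y x) t x -
        1 / 2 * ∑ s : ↥B × Fin D, ∑ t' : ↥B × Fin D, latticeMaxwellBlockCov B D s t' *
          SteinOU.gaussInterp (latticeMaxwellBlockLaw B D)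
            (fun y => fderiv ℝ (fun y' => fderiv ℝ g y' (latticeMaxwellBlockBasis B D s)) y
              (latticeMaxwellBlockBasis B D t')) t x := by
  classical
  obtain ⟨ht0, ht1⟩ := ht
  haveI := isProbabilityMeasure_latticeMaxwellBlockLaw B D hd
  have hγ1 := integrable_norm_latticeMaxwellBlockLaw B D hd
  have hC0 : 0 ≤ C := (norm_nonneg _).trans (hC 0)
  have hC₂0 : 0 ≤ C₂ := (norm_nonneg (fderiv ℝ (fderiv ℝ g) 0)).trans (hC₂ 0)
  have hs1 : 0 < Real.sqrt (1 - t) := Real.sqrt_pos.2 (by linarith)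
  have hs1le : Real.sqrt (1 - t) ≤ 1 := (Real.sqrt_le_one (x := 1 - t)).mpr (by linarith)
  have hgd : Differentiable ℝ g := hg.differentiable (by norm_num)
  have hDc : Continuous (fderiv ℝ g) := hg.continuous_fderiv (by norm_num)
  have hAc : Continuous fun z : ↥B → Fin D → ℝ => Real.sqrt t • x + Real.sqrt (1 - t) • z := by
    fun_prop
  -- the pulled-back function `F = g ∘ (z ↦ √t x + √(1−t) z)` and its derivatives
  have hFcd : ContDiff ℝ 2 (fun z : ↥B → Fin D → ℝ => g (Real.sqrt t • x + Real.sqrt (1 - t) • z)) :=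
    hg.comp (by fun_prop)
  have hF1 : ∀ z w : ↥B → Fin D → ℝ, fderiv ℝ (fun z => g (Real.sqrt t • x + Real.sqrt (1 - t) • z)) z w =
      Real.sqrt (1 - t) * fderiv ℝ g (Real.sqrt t • x + Real.sqrt (1 - t) • z) w := fun z w =>
    fderiv_comp_interp_apply hgd t x z w
  have hFK₁ : ∀ z, ‖fderiv ℝ (fun z : ↥B → Fin D → ℝ => g (Real.sqrt t • x + Real.sqrt (1 - t) • z)) z‖ ≤ C := fun z => by
    refine ContinuousLinearMap.opNorm_le_bound _ hC0 fun w => ?_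
    rw [hF1, norm_mul, Real.norm_of_nonneg hs1.le]
    calc Real.sqrt (1 - t) * ‖fderiv ℝ g (Real.sqrt t • x + Real.sqrt (1 - t) • z) w‖ ≤ 1 * (C * ‖w‖) := by
          gcongr
          rw [Real.norm_eq_abs]; exact SteinOU.abs_fderiv_apply_le hC _ _
      _ = C * ‖w‖ := one_mul _
  have hgs : ∀ s, ContDiff ℝ 1 (fun y => fderiv ℝ g y (latticeMaxwellBlockBasis B D s)) := fun s =>
    SteinOU.contDiff_one_fderiv_apply hg (latticeMaxwellBlockBasis B D s)
  have hFs_eq : ∀ s, (fun z : ↥B → Fin D → ℝ => fderiv ℝ (fun z => g (Real.sqrt t • x + Real.sqrt (1 - t) • z)) z (latticeMaxwellBlockBasis B D s)) =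
      fun z => Real.sqrt (1 - t) * fderiv ℝ g (Real.sqrt t • x + Real.sqrt (1 - t) • z) (latticeMaxwellBlockBasis B D s) :=
    fun s => funext fun z => hF1 z (latticeMaxwellBlockBasis B D s)
  have hF2 : ∀ s (z w : ↥B → Fin D → ℝ),
      fderiv ℝ (fun z' => fderiv ℝ (fun z => g (Real.sqrt t • x + Real.sqrt (1 - t) • z)) z' (latticeMaxwellBlockBasis B D s)) z w =
        (1 - t) * fderiv ℝ (fun y => fderiv ℝ g y (latticeMaxwellBlockBasis B D s)) (Real.sqrt t • x + Real.sqrt (1 - t) • z) w := by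
    intro s z w
    have hcomp : HasFDerivAt (fun z' : ↥B → Fin D → ℝ => fderiv ℝ g
        (Real.sqrt t • x + Real.sqrt (1 - t) • z') (latticeMaxwellBlockBasis B D s))
        ((fderiv ℝ (fun y => fderiv ℝ g y (latticeMaxwellBlockBasis B D s)) (Real.sqrt t • x + Real.sqrt (1 - t) • z)).comp
          (Real.sqrt (1 - t) • ContinuousLinearMap.id ℝ _)) z :=
      ((hgs s).differentiable one_ne_zero _).hasFDerivAt.comp z (hasFDerivAt_interp_affine t x z)
    rw [hFs_eq s, (hcomp.const_mul (Real.sqrt (1 - t))).fderiv]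
    simp only [smul_apply, ContinuousLinearMap.comp_apply, ContinuousLinearMap.id_apply, map_smul,
      smul_eq_mul]
    rw [← mul_assoc, Real.mul_self_sqrt (by linarith : (0 : ℝ) ≤ 1 - t)]
  have hFK₂ : ∀ s z, ‖fderiv ℝ (fun z' => fderiv ℝ (fun z : ↥B → Fin D → ℝ => g (Real.sqrt t • x + Real.sqrt (1 - t) • z)) z'
      (latticeMaxwellBlockBasis B D s)) z‖ ≤ C₂ := by
    intro s z
    refine ContinuousLinearMap.opNorm_le_bound _ hC₂0 fun w => ?_
    rw [hF2, norm_mul, Real.norm_of_nonneg (by linarith : (0 : ℝ) ≤ 1 - t)]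
    have h1 : ‖fderiv ℝ (fun y => fderiv ℝ g y (latticeMaxwellBlockBasis B D s)) (Real.sqrt t • x + Real.sqrt (1 - t) • z) w‖ ≤ C₂ * ‖w‖ :=
      (ContinuousLinearMap.le_opNorm _ _).trans (mul_le_mul_of_nonneg_right
        ((SteinOU.norm_fderiv_fderiv_apply_le hg hC₂ (latticeMaxwellBlockBasis B D s) (Real.sqrt t • x + Real.sqrt (1 - t) • z)).trans
          (by nlinarith [norm_latticeMaxwellBlockBasis_le B D s, norm_nonneg (latticeMaxwellBlockBasis B D s)]))
        (norm_nonneg _))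
    calc (1 - t) * ‖fderiv ℝ (fun y => fderiv ℝ g y (latticeMaxwellBlockBasis B D s)) (Real.sqrt t • x + Real.sqrt (1 - t) • z) w‖ ≤ 1 * (C₂ * ‖w‖) := by
          gcongr; linarith
      _ = C₂ * ‖w‖ := one_mul _
  -- Gaussian integration by parts for `F`: `E[Dg(Z_{x,t})[Z]] = √(1−t) Σ Γ E[∂²g(Z_{x,t})]`
  have hIBP := integral_fderiv_apply_self_latticeMaxwellBlockLaw B D hd hFcd hFK₁ hFK₂
  have hl : ∫ z, fderiv ℝ (fun z : ↥B → Fin D → ℝ => g (Real.sqrt t • x + Real.sqrt (1 - t) • z)) z z ∂latticeMaxwellBlockLaw B D =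
      Real.sqrt (1 - t) * ∫ z, fderiv ℝ g (Real.sqrt t • x + Real.sqrt (1 - t) • z) z ∂latticeMaxwellBlockLaw B D := by
    rw [← integral_const_mul]; exact integral_congr_ae (Eventually.of_forall fun z => hF1 z z)
  have hr : ∀ s t', ∫ z, fderiv ℝ (fun z' => fderiv ℝ (fun z : ↥B → Fin D → ℝ => g (Real.sqrt t • x + Real.sqrt (1 - t) • z)) z'
      (latticeMaxwellBlockBasis B D s)) z (latticeMaxwellBlockBasis B D t') ∂latticeMaxwellBlockLaw B D =
        (1 - t) * ∫ z, fderiv ℝ (fun y => fderiv ℝ g y (latticeMaxwellBlockBasis B D s)) (Real.sqrt t • x + Real.sqrt (1 - t) • z) (latticeMaxwellBlockBasis B D t') ∂latticeMaxwellBlockLaw B D :=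
    fun s t' => by
    rw [← integral_const_mul]; exact integral_congr_ae (Eventually.of_forall fun z => hF2 s z _)
  rw [hl] at hIBP
  have hIBP' : ∫ z, fderiv ℝ g (Real.sqrt t • x + Real.sqrt (1 - t) • z) z ∂latticeMaxwellBlockLaw B D = Real.sqrt (1 - t) *
      ∑ s : ↥B × Fin D, ∑ t' : ↥B × Fin D, latticeMaxwellBlockCov B D s t' *
        ∫ z, fderiv ℝ (fun y => fderiv ℝ g y (latticeMaxwellBlockBasis B D s)) (Real.sqrt t • x + Real.sqrt (1 - t) • z) (latticeMaxwellBlockBasis B D t') ∂latticeMaxwellBlockLaw B D := by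
    have key : ∫ z, fderiv ℝ g (Real.sqrt t • x + Real.sqrt (1 - t) • z) z ∂latticeMaxwellBlockLaw B D =
        (Real.sqrt (1 - t))⁻¹ * (Real.sqrt (1 - t) * ∫ z, fderiv ℝ g (Real.sqrt t • x + Real.sqrt (1 - t) • z) z ∂latticeMaxwellBlockLaw B D) := by
      field_simp
    rw [key, hIBP, Finset.mul_sum, Finset.mul_sum]
    refine Finset.sum_congr rfl fun s _ => ?_
    rw [Finset.mul_sum, Finset.mul_sum]
    refine Finset.sum_congr rfl fun t' _ => ?_
    rw [hr s t']
    have hrr : Real.sqrt (1 - t) * Real.sqrt (1 - t) = 1 - t := Real.mul_self_sqrt (by linarith)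
    generalize Real.sqrt (1 - t) = r at hrr hs1 ⊢
    rw [← hrr, inv_mul_eq_iff_eq_mul₀ hs1.ne']
    ring
  -- split the integrand and conclude
  have hi1 : Integrable (fun z => fderiv ℝ g (Real.sqrt t • x + Real.sqrt (1 - t) • z) x) (latticeMaxwellBlockLaw B D) :=
    Integrable.mono' (integrable_const (C * ‖x‖))
      (((hDc.comp hAc).clm_apply continuous_const).aestronglyMeasurable)
      (Eventually.of_forall fun z => by
        rw [Real.norm_eq_abs]; exact SteinOU.abs_fderiv_apply_le hC _ _)
  have hi2 : Integrable (fun z => fderiv ℝ g (Real.sqrt t • x + Real.sqrt (1 - t) • z) z) (latticeMaxwellBlockLaw B D) :=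
    Integrable.mono' (hγ1.const_mul C) (((hDc.comp hAc).clm_apply continuous_id).aestronglyMeasurable)
      (Eventually.of_forall fun z => by
        rw [Real.norm_eq_abs]; exact SteinOU.abs_fderiv_apply_le hC _ _)
  have hsplit : ∀ z, fderiv ℝ g (Real.sqrt t • x + Real.sqrt (1 - t) • z) ((1 / (2 * Real.sqrt t)) • x - (1 / (2 * Real.sqrt (1 - t))) • z) =
      1 / (2 * Real.sqrt t) * fderiv ℝ g (Real.sqrt t • x + Real.sqrt (1 - t) • z) x - 1 / (2 * Real.sqrt (1 - t)) * fderiv ℝ g (Real.sqrt t • x + Real.sqrt (1 - t) • z) z := by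
    intro z; rw [map_sub, map_smul, map_smul, smul_eq_mul, smul_eq_mul]
  simp_rw [hsplit]
  rw [integral_sub (hi1.const_mul _) (hi2.const_mul _), integral_const_mul, integral_const_mul, hIBP']
  simp only [SteinOU.gaussInterp]
  have e2 : 1 / (2 * Real.sqrt (1 - t)) * Real.sqrt (1 - t) = 1 / 2 := by field_simp
  rw [← mul_assoc, e2]

/-! ### Stein's equation -/

/-- **Stein's equation for the lattice-Maxwell block law** (Meckes 2009, Lemma 1 (3), `Σ = Γ_B`):
for `g ∈ C²` with bounded first and second derivative, `U_o g = latticeMaxwellBlockStein B D g`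
satisfies `−L_B (U_o g)(y) = g(y) − γ_B(g)` at every `y` (`d ≥ 3`). Proof as printed: write
`g(y) − E g(Z) = ∫₀¹ d/dt E g(Z_{y,t}) dt`, express the derivative through Gaussian integration by
parts as `−(2t)⁻¹ L_B E g(Z_{·,t})(y)`, and exchange `L_B` with the `dt`-integral using the derivative
formulas for `U_o g`. [cite: Meckes2009, Lemma 1 (3)] -/
theorem neg_latticeMaxwellBlockGenerator_stein (hd : 3 ≤ d) {g : (↥B → Fin D → ℝ) → ℝ} {C C₂ : ℝ}
    (hg : ContDiff ℝ 2 g) (hC : ∀ y, ‖fderiv ℝ g y‖ ≤ C)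
    (hC₂ : ∀ y, ‖fderiv ℝ (fderiv ℝ g) y‖ ≤ C₂) (y : ↥B → Fin D → ℝ) :
    -latticeMaxwellBlockGenerator B D (latticeMaxwellBlockStein B D g) y =
      g y - ∫ z, g z ∂latticeMaxwellBlockLaw B D := by
  classical
  haveI := isProbabilityMeasure_latticeMaxwellBlockLaw B D hd
  have hγ1 : Integrable (fun z : ↥B → Fin D → ℝ => ‖z‖) (latticeMaxwellBlockLaw B D) :=
    integrable_norm_latticeMaxwellBlockLaw B D hd
  have hg1 : ContDiff ℝ 1 g := hg.of_le one_le_two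
  have hC₂0 : 0 ≤ C₂ := (norm_nonneg (fderiv ℝ (fderiv ℝ g) 0)).trans (hC₂ 0)
  have hU : latticeMaxwellBlockStein B D g = SteinOU.steinInverse (latticeMaxwellBlockLaw B D) g := rfl
  -- second derivatives and first derivative of `U_o g` as `dt`-integrals
  have h2 : ∀ s t', fderiv ℝ (fun y' => fderiv ℝ (latticeMaxwellBlockStein B D g) y' (latticeMaxwellBlockBasis B D s)) y (latticeMaxwellBlockBasis B D t') =
      ∫ t in Set.Ioo (0 : ℝ) 1, (1 / 2 : ℝ) * SteinOU.gaussInterp (latticeMaxwellBlockLaw B D)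
        (fun z => fderiv ℝ (fun y' => fderiv ℝ g y' (latticeMaxwellBlockBasis B D s)) z (latticeMaxwellBlockBasis B D t')) t y := fun s t' => by
    rw [hU]; exact SteinOU.fderiv_fderiv_steinInverse_apply hg hC hC₂ hγ1 (latticeMaxwellBlockBasis B D s) (latticeMaxwellBlockBasis B D t') y
  have h1 : fderiv ℝ (latticeMaxwellBlockStein B D g) y y =
      ∫ t in Set.Ioo (0 : ℝ) 1, (2 * t)⁻¹ * (Real.sqrt t *
        SteinOU.gaussInterp (latticeMaxwellBlockLaw B D) (fun y' => fderiv ℝ g y' y) t y) := by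
    rw [hU]; exact SteinOU.fderiv_steinInverse_apply hg1 hC hγ1 y y
  -- integrability of the bounded, measurable Hessian pieces on `(0,1)`
  have hG₂b : ∀ s t' t, |SteinOU.gaussInterp (latticeMaxwellBlockLaw B D)
      (fun z => fderiv ℝ (fun y' => fderiv ℝ g y' (latticeMaxwellBlockBasis B D s)) z (latticeMaxwellBlockBasis B D t')) t y| ≤ C₂ := by
    intro s t' t
    simp only [SteinOU.gaussInterp]
    have hpt : ∀ z, ‖fderiv ℝ (fun y' => fderiv ℝ g y' (latticeMaxwellBlockBasis B D s))
        (Real.sqrt t • y + Real.sqrt (1 - t) • z) (latticeMaxwellBlockBasis B D t')‖ ≤ C₂ := fun z =>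
      (ContinuousLinearMap.le_opNorm _ _).trans (by
        have h1 := SteinOU.norm_fderiv_fderiv_apply_le hg hC₂ (latticeMaxwellBlockBasis B D s)
          (Real.sqrt t • y + Real.sqrt (1 - t) • z)
        nlinarith [norm_latticeMaxwellBlockBasis_le B D s, norm_latticeMaxwellBlockBasis_le B D t',
          norm_nonneg (latticeMaxwellBlockBasis B D s), norm_nonneg (latticeMaxwellBlockBasis B D t'), norm_nonneg (fderiv ℝ (fun y' => fderiv ℝ g y' (latticeMaxwellBlockBasis B D s))
          (Real.sqrt t • y + Real.sqrt (1 - t) • z))])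
    have h := norm_integral_le_of_norm_le_const (μ := latticeMaxwellBlockLaw B D) (Eventually.of_forall hpt)
    rw [Real.norm_eq_abs] at h
    simpa using h
  have hG₂m : ∀ s t', Measurable fun t => SteinOU.gaussInterp (latticeMaxwellBlockLaw B D)
      (fun z => fderiv ℝ (fun y' => fderiv ℝ g y' (latticeMaxwellBlockBasis B D s)) z (latticeMaxwellBlockBasis B D t')) t y := fun s t' =>
    SteinOU.measurable_gaussInterp_of_continuous
      (((SteinOU.contDiff_one_fderiv_apply hg (latticeMaxwellBlockBasis B D s)).continuous_fderiv one_ne_zero).clm_apply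
        continuous_const) y
  have hG₂i : ∀ s t', IntegrableOn (fun t => (1 / 2 : ℝ) * SteinOU.gaussInterp (latticeMaxwellBlockLaw B D)
      (fun z => fderiv ℝ (fun y' => fderiv ℝ g y' (latticeMaxwellBlockBasis B D s)) z (latticeMaxwellBlockBasis B D t')) t y) (Set.Ioo (0 : ℝ) 1) :=
    fun s t' => Integrable.mono' (integrable_const (1 / 2 * C₂))
      (((hG₂m s t').const_mul _).aestronglyMeasurable)
      (Eventually.of_forall fun t => by
        rw [Real.norm_eq_abs, abs_mul, abs_of_nonneg (by norm_num : (0 : ℝ) ≤ 1 / 2)]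
        exact mul_le_mul_of_nonneg_left (hG₂b s t' t) (by norm_num))
  -- the fundamental theorem of calculus and the generator form of the `t`-derivative, on `(0,1)`
  have hFTC := SteinOU.sub_integral_eq_integral_deriv_gaussInterp (γ := latticeMaxwellBlockLaw B D) hg1 hC hγ1 y
  have hD : Set.EqOn
      (fun t : ℝ => ∫ z, fderiv ℝ g (Real.sqrt t • y + Real.sqrt (1 - t) • z)
        ((1 / (2 * Real.sqrt t)) • y - (1 / (2 * Real.sqrt (1 - t))) • z) ∂latticeMaxwellBlockLaw B D)
      (fun t => 1 / (2 * Real.sqrt t) * SteinOU.gaussInterp (latticeMaxwellBlockLaw B D) (fun y' => fderiv ℝ g y' y) t y -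
        ∑ s : ↥B × Fin D, ∑ t' : ↥B × Fin D, latticeMaxwellBlockCov B D s t' *
          ((1 / 2 : ℝ) * SteinOU.gaussInterp (latticeMaxwellBlockLaw B D)
            (fun z => fderiv ℝ (fun y' => fderiv ℝ g y' (latticeMaxwellBlockBasis B D s)) z (latticeMaxwellBlockBasis B D t')) t y))
      (Set.Ioo (0 : ℝ) 1) := by
    intro t ht
    simp only
    rw [deriv_gaussInterp_eq B D hd hg hC hC₂ y ht, Finset.mul_sum]
    congr 1
    refine Finset.sum_congr rfl fun s _ => ?_
    rw [Finset.mul_sum]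
    refine Finset.sum_congr rfl fun t' _ => ?_
    ring
  rw [setIntegral_congr_fun measurableSet_Ioo hD] at hFTC
  -- integrability of the two parts of the right-hand integrand on `(0,1)`
  have hsumI : IntegrableOn (fun t : ℝ => ∑ s : ↥B × Fin D, ∑ t' : ↥B × Fin D,
      latticeMaxwellBlockCov B D s t' * ((1 / 2 : ℝ) * SteinOU.gaussInterp (latticeMaxwellBlockLaw B D)
        (fun z => fderiv ℝ (fun y' => fderiv ℝ g y' (latticeMaxwellBlockBasis B D s)) z (latticeMaxwellBlockBasis B D t')) t y)) (Set.Ioo (0 : ℝ) 1) :=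
    integrable_finsetSum _ fun s _ => integrable_finsetSum _ fun t' _ => (hG₂i s t').const_mul _
  have hderI := SteinOU.integrableOn_deriv_gaussInterp (γ := latticeMaxwellBlockLaw B D) hg1 hC hγ1 y
  have h1I : IntegrableOn (fun t : ℝ => 1 / (2 * Real.sqrt t) *
      SteinOU.gaussInterp (latticeMaxwellBlockLaw B D) (fun y' => fderiv ℝ g y' y) t y) (Set.Ioo (0 : ℝ) 1) := by
    have h := (hderI.congr_fun hD measurableSet_Ioo).add hsumI
    exact h.congr_fun (fun t _ => by simp only [Pi.add_apply, sub_add_cancel]) measurableSet_Ioo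
  -- assemble
  rw [latticeMaxwellBlockGenerator, neg_sub, h1]
  simp_rw [h2]
  rw [hFTC, integral_sub h1I hsumI,
    integral_finsetSum _ fun s _ => integrable_finsetSum _ fun t' _ => (hG₂i s t').const_mul _]
  congr 1
  · refine setIntegral_congr_fun measurableSet_Ioo fun t ht => ?_
    obtain ⟨ht0, ht1⟩ := ht
    have hst : Real.sqrt t ≠ 0 := (Real.sqrt_pos.2 ht0).ne'
    rw [← mul_assoc]
    congr 1
    rw [show (2 * t)⁻¹ * Real.sqrt t = Real.sqrt t / (2 * (Real.sqrt t * Real.sqrt t)) by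
      rw [Real.mul_self_sqrt ht0.le]; ring]
    field_simp
  · refine Finset.sum_congr rfl fun s _ => ?_
    rw [integral_finsetSum _ fun t' _ => (hG₂i s t').const_mul _]
    refine Finset.sum_congr rfl fun t' _ => ?_
    simp only [integral_const_mul]

/-- **DISCHARGE of `Meckes2009_lemma1_steinEquation_latticeMaxwellBlock`** (Meckes 2009, Lemma 1
(3) at the lattice-Maxwell block law): for `g ∈ C^∞` with bounded `∇g` and `∇²g`,
`−L_B (U_o g) = g − γ_B(g)` pointwise (`d ≥ 3`). [cite: Meckes2009, Lemma 1 (3)] -/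
theorem Meckes2009_lemma1_steinEquation_latticeMaxwellBlock_holds :
    Meckes2009_lemma1_steinEquation_latticeMaxwellBlock := by
  intro d D hd B g hg hC hC₂ y
  obtain ⟨C, hC⟩ := hC
  obtain ⟨C₂, hC₂⟩ := hC₂
  exact neg_latticeMaxwellBlockGenerator_stein B D hd
    (hg.of_le (by exact WithTop.coe_le_coe.2 (le_top : (2 : ℕ∞) ≤ ⊤))) hC
    (fun x => SteinOU.norm_fderiv_fderiv_le_of_iteratedFDeriv hC₂ x) y

end Block

end Literature.MathematicalPhysics.QuantumFieldTheory

end
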